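import Summits.QuantumFields.GaugeBoot.SOMasterLoopCalculus
import Summits.QuantumFields.GaugeBoot.ZdWilsonHaarShiftAt
import Literature.MathematicalPhysics.QuantumFieldTheory.Chatterjee2019LargeN.MasterLoopEquation
import HarnessLib

/-!
# Derivatives of `SO(N)` Wilson loop variables along the one-link flow: insertion sums (gauge-boot, ADDENDUM 27 part M3)

HONEST FRAMING (cell `pub-gaugeboot`, page 1 of every file): the venture produces certified bounds
on lattice expectations at stated coupling, gauge group, dimension and torus size; NOT a mass gap,
NOT a continuum limit, NOT a string tension; NOT Yang–Mills-summit-bearing (barriers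
`FixedCouplingUltralocality`, `PerturbativeInvisibility`).  Matrix calculus on Chatterjee's edge words; nothing about
the large-`N` limit is claimed here.

## Content

Fourth file of the lane's programme on the tree's NAMED FACT `Chatterjee2019LargeN.UnsymmetrizedMasterLoopEquation`
(Chatterjee, CMP 366 (2019), Theorem 8.1).  For Chatterjee's edge words `l : Word d = List (DEdge d)` and `SO(N)`
configurations `U : LGConfig d (SO N)` (`= ZdGaugeConfig`), the Wilson loop variable read through the complexified
defining representation is the ordered product of the LETTER MATRICES `letterMat U a = soRep(Q_a^{±1})`
(`soRep_wordHolonomy`, `ofReal_wilsonLoopVar`).  Along the one-link flow `U ↦ U[ε ↦ k(t) U_ε]`,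
`soRep(k t) = exp(tX)`, every letter is a factor `L exp(tY) R` of part M2 (`flowFactor`: `Y = X` at `ε`, `Y = −X`
read from the right at `ε⁻¹`, `Y = 0` elsewhere), so by the product rule:

* ★ `hasDerivAt_prod_letterMat` — the derivative of `Π_k letterMat` at `t = 0` is the INSERTION SUM
  `Σ_x Π_k (letters with the x-th replaced by insMat)`, `insMat = X·M` at a forward `ε`, `−M·X` at a backward one,
  `0` at other letters;
* ★ `hasDerivAt_insProd` — the derivative of one insertion product is the DOUBLE-INSERTION SUM over a second position
  `y`, the diagonal `y = x` carrying `ins2Mat = X·X·M` resp. `M·X·X` (the Casimir slot of Theorem 8.1);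
* `soLatticeRep` — `SO(N)` with `soRep` as a lattice representation (faithful, continuous, unitary), so that the
  lane's one-link Schwinger–Dyson identity (`IsHaarShiftStateAt.integral_shiftDeriv_eq_complex`, part M0) applies;
* continuity and the cylinder property of all these functions of `U` are in the sequel `SOMasterLoopRegularity`.

References: S. Chatterjee, Comm. Math. Phys. 366 (2019) §§5–8 (Stein's method: the same derivatives organised through
`∂/∂q_{ij}`); the lane's `WordDerivative.lean` (the step-word analogue).  Everything is `[folklore]`.
-/

noncomputable section

open NormedSpace
open scoped Matrix.Norms.Frobenius Matrix
open Literature.MathematicalPhysics.QuantumLattice (LGConfig ZdEdge)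
open Literature.MathematicalPhysics.QuantumFieldTheory (LatticeRep)
open Literature.MathematicalPhysics.QuantumFieldTheory (Chatterjee2019LargeN.Word Chatterjee2019LargeN.wordHolonomy)
open Literature.MathematicalPhysics.QuantumFieldTheory.Chatterjee2019LargeN
  (SO soRep soRep_apply DEdge wilsonLoopVar isSpecialOrthogonalModel_soRep)
open Summit.QuantumFields.YangMills.Cruxes.CurvatureAmnesia.WardDefect.SchwingerDyson (oneParam_neg)

namespace Summit.QuantumFields.GaugeBoot

namespace SOMasterLoop

variable {d N : ℕ}

/-! ## `SO(N)` as a lattice representation -/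

/-- `soRep Q` is unitary (a real orthogonal matrix read in `ℂ`). [folklore] -/
theorem soRep_mem_unitaryGroup (Q : SO N) : soRep N Q ∈ Matrix.unitaryGroup (Fin N) ℂ := by
  rw [Matrix.mem_unitaryGroup_iff, soRep_apply]
  have hQ : (Q : Matrix (Fin N) (Fin N) ℝ) * (Q : Matrix (Fin N) (Fin N) ℝ)ᵀ = 1 := by
    have h := Matrix.mem_unitaryGroup_iff.1 Q.2.1
    rwa [Matrix.star_eq_conjTranspose, Matrix.conjTranspose_eq_transpose_of_trivial] at h
  have hstar : star ((Q : Matrix (Fin N) (Fin N) ℝ).map (Complex.ofRealHom : ℝ →+* ℂ)) =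
      ((Q : Matrix (Fin N) (Fin N) ℝ)ᵀ).map (Complex.ofRealHom : ℝ →+* ℂ) := by
    ext i j
    simp [Matrix.star_apply, Matrix.map_apply, Matrix.transpose_apply]
  rw [hstar, ← Matrix.map_mul, hQ, Matrix.map_one Complex.ofRealHom (map_zero _) (map_one _)]

/-- **`SO(N)` with its complexified defining representation is a lattice representation** (faithful, continuous,
unitary), so the lane's one-link machinery applies. [folklore] -/
def soLatticeRep (N : ℕ) : LatticeRep (SO N) :=
  ⟨N, soRep N, (isSpecialOrthogonalModel_soRep N).1, (isSpecialOrthogonalModel_soRep N).2.1, soRep_mem_unitaryGroup⟩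

/-- Unfolding lemmas for `soLatticeRep`. [folklore] -/
@[simp] theorem soLatticeRep_N : (soLatticeRep N).N = N := rfl

/-- Unfolding lemma. [folklore] -/
theorem soLatticeRep_ρ : (soLatticeRep N).ρ = soRep N := rfl

/-! ## Letter matrices and the Wilson loop variable as a product -/

/-- The complex matrix of a letter: `soRep(Q_e)` for `a = e ∈ E⁺`, `soRep(Q_e⁻¹)` for `a = e⁻¹`. [folklore] -/
def letterMat (U : LGConfig d (SO N)) (a : DEdge d) : Matrix (Fin N) (Fin N) ℂ :=
  soRep N (if a.2 then U a.1 else (U a.1)⁻¹)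

/-- `soRep(hol_l) = Π_k letterMat` (the representation is multiplicative). [folklore] -/
theorem soRep_wordHolonomy (U : LGConfig d (SO N)) (l : Chatterjee2019LargeN.Word d) :
    soRep N (Chatterjee2019LargeN.wordHolonomy U l) = (l.map (letterMat U)).prod := by
  rw [Chatterjee2019LargeN.wordHolonomy, map_list_prod, List.map_map]
  rfl

/-- The trace of a real matrix read in `ℂ` is the real trace. [folklore] -/
theorem trace_map_ofReal (A : Matrix (Fin N) (Fin N) ℝ) :
    (A.map (Complex.ofRealHom : ℝ →+* ℂ)).trace = ((A.trace : ℝ) : ℂ) := by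
  simp [Matrix.trace, Matrix.map_apply]

/-- **The Wilson loop variable in `ℂ`**: `(W_l : ℂ) = tr soRep(hol_l) = tr Π_k letterMat`. [folklore] -/
theorem ofReal_wilsonLoopVar (N : ℕ) (l : Chatterjee2019LargeN.Word d) (U : LGConfig d (SO N)) :
    ((wilsonLoopVar N l U : ℝ) : ℂ) = ((l.map (letterMat U)).prod).trace := by
  rw [← soRep_wordHolonomy, soRep_apply, trace_map_ofReal, wilsonLoopVar]

/-! ## The one-link flow on letters -/

section Flow

variable (ε : ZdEdge d) (X : Matrix (Fin N) (Fin N) ℂ)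

/-- The flow factor of a letter along `U ↦ U[ε ↦ k(t)U_ε]`, `soRep(k t) = exp(tX)`: `exp(tX)·M` at a forward `ε`,
`M·exp(−tX)` at a backward one, the constant `M` elsewhere (`M = letterMat U a`). [folklore] -/
def flowFactor (U : LGConfig d (SO N)) (a : DEdge d) : ExpFactor N :=
  if a.1 = ε then (if a.2 then ⟨1, X, letterMat U a⟩ else ⟨letterMat U a, -X, 1⟩) else ⟨letterMat U a, 0, 1⟩

/-- The INSERTION MATRIX of a letter: `X·M` at a forward `ε`, `−(M·X)` at a backward one, `0` elsewhere — the
derivative of the flow factor. [folklore] -/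
def insMat (U : LGConfig d (SO N)) (a : DEdge d) : Matrix (Fin N) (Fin N) ℂ :=
  if a.1 = ε then (if a.2 then X * letterMat U a else -(letterMat U a * X)) else 0

/-- The second-order flow factor (the flow of an insertion matrix): `X exp(tX) M` at a forward `ε`,
`M exp(−tX)(−X)` at a backward one, `0` elsewhere. [folklore] -/
def derivFactor (U : LGConfig d (SO N)) (a : DEdge d) : ExpFactor N :=
  if a.1 = ε then (if a.2 then ⟨X, X, letterMat U a⟩ else ⟨letterMat U a, -X, -X⟩) else ⟨0, 0, 0⟩

/-- The DOUBLE-INSERTION MATRIX at one letter: `X·X·M` at a forward `ε`, `M·X·X` at a backward one, `0` elsewhere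
(the Casimir slot). [folklore] -/
def ins2Mat (U : LGConfig d (SO N)) (a : DEdge d) : Matrix (Fin N) (Fin N) ℂ :=
  if a.1 = ε then (if a.2 then X * X * letterMat U a else letterMat U a * X * X) else 0

/-- At `t = 0` the flow factor is the letter matrix. [folklore] -/
theorem flowFactor_eval₀ (U : LGConfig d (SO N)) (a : DEdge d) : (flowFactor ε X U a).eval₀ = letterMat U a := by
  unfold flowFactor
  split_ifs <;> simp [ExpFactor.eval₀]

/-- The derivative of the flow factor is the insertion matrix. [folklore] -/
theorem flowFactor_deriv (U : LGConfig d (SO N)) (a : DEdge d) : (flowFactor ε X U a).deriv = insMat ε X U a := by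
  unfold flowFactor insMat
  split_ifs <;> simp [ExpFactor.deriv]

/-- At `t = 0` the second-order flow factor is the insertion matrix. [folklore] -/
theorem derivFactor_eval₀ (U : LGConfig d (SO N)) (a : DEdge d) : (derivFactor ε X U a).eval₀ = insMat ε X U a := by
  unfold derivFactor insMat
  split_ifs <;> simp [ExpFactor.eval₀]

/-- The derivative of the second-order flow factor is the double-insertion matrix. [folklore] -/
theorem derivFactor_deriv (U : LGConfig d (SO N)) (a : DEdge d) : (derivFactor ε X U a).deriv = ins2Mat ε X U a := by
  unfold derivFactor ins2Mat
  split_ifs <;> simp [ExpFactor.deriv]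

/-- Flow factor of the forward letter at `ε`. [folklore] -/
theorem flowFactor_eval_true (U : LGConfig d (SO N)) (t : ℝ) :
    (flowFactor ε X U (ε, true)).eval t = exp ((t : ℂ) • X) * letterMat U (ε, true) := by
  simp [flowFactor, ExpFactor.eval]

/-- Flow factor of the backward letter at `ε`. [folklore] -/
theorem flowFactor_eval_false (U : LGConfig d (SO N)) (t : ℝ) :
    (flowFactor ε X U (ε, false)).eval t = letterMat U (ε, false) * exp (-((t : ℂ) • X)) := by
  simp [flowFactor, ExpFactor.eval, smul_neg]

/-- Flow factor of a letter off `ε`. [folklore] -/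
theorem flowFactor_eval_of_ne (U : LGConfig d (SO N)) (t : ℝ) {a : DEdge d} (h : a.1 ≠ ε) :
    (flowFactor ε X U a).eval t = letterMat U a := by
  simp [flowFactor, ExpFactor.eval, h]

/-- Insertion matrix of the forward letter at `ε`. [folklore] -/
theorem insMat_true (U : LGConfig d (SO N)) : insMat ε X U (ε, true) = X * letterMat U (ε, true) := by
  simp [insMat]

/-- Insertion matrix of the backward letter at `ε`. [folklore] -/
theorem insMat_false (U : LGConfig d (SO N)) : insMat ε X U (ε, false) = -(letterMat U (ε, false) * X) := by
  simp [insMat]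

/-- Insertion matrix of a letter off `ε` vanishes. [folklore] -/
theorem insMat_of_ne (U : LGConfig d (SO N)) {a : DEdge d} (h : a.1 ≠ ε) : insMat ε X U a = 0 := by
  simp [insMat, h]

/-- Second-order flow factor of the forward letter at `ε`. [folklore] -/
theorem derivFactor_eval_true (U : LGConfig d (SO N)) (t : ℝ) :
    (derivFactor ε X U (ε, true)).eval t = X * exp ((t : ℂ) • X) * letterMat U (ε, true) := by
  simp [derivFactor, ExpFactor.eval]

/-- Second-order flow factor of the backward letter at `ε`. [folklore] -/
theorem derivFactor_eval_false (U : LGConfig d (SO N)) (t : ℝ) :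
    (derivFactor ε X U (ε, false)).eval t = letterMat U (ε, false) * exp (-((t : ℂ) • X)) * (-X) := by
  simp [derivFactor, ExpFactor.eval, smul_neg]

/-- Second-order flow factor of a letter off `ε` vanishes. [folklore] -/
theorem derivFactor_eval_of_ne (U : LGConfig d (SO N)) (t : ℝ) {a : DEdge d} (h : a.1 ≠ ε) :
    (derivFactor ε X U a).eval t = 0 := by
  simp [derivFactor, ExpFactor.eval, h]

variable {ε X} {k : ℝ → SO N}

/-- A forward letter at the shifted link picks up the shift on the left. [folklore] -/
theorem letterMat_update_true (U : LGConfig d (SO N)) (g : SO N) :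
    letterMat (Function.update U ε (g * U ε)) (ε, true) = soRep N g * letterMat U (ε, true) := by
  simp [letterMat]

/-- A backward letter at the shifted link picks up the inverse shift on the right. [folklore] -/
theorem letterMat_update_false (U : LGConfig d (SO N)) (g : SO N) :
    letterMat (Function.update U ε (g * U ε)) (ε, false) = letterMat U (ε, false) * soRep N g⁻¹ := by
  simp [letterMat, mul_inv_rev]

/-- Letters of other links do not move. [folklore] -/
theorem letterMat_update_of_ne (U : LGConfig d (SO N)) (v : SO N) {a : DEdge d} (h : a.1 ≠ ε) :
    letterMat (Function.update U ε v) a = letterMat U a := by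
  unfold letterMat; rw [Function.update_of_ne h]

/-- `soRep(k(−t)) = exp(−tX)`. [folklore] -/
theorem soRep_oneParam_neg (hX : ∀ t, soRep N (k t) = exp ((t : ℂ) • X)) (t : ℝ) :
    soRep N (k (-t)) = exp (-((t : ℂ) • X)) := by
  rw [hX]; push_cast; rw [neg_smul]

/-- **Letters along the flow**: `letterMat (U[ε ↦ k(t)U_ε]) a = (flowFactor a)(t)`. [folklore] -/
theorem letterMat_update (hk : ∀ s t, k (s + t) = k s * k t) (hX : ∀ t, soRep N (k t) = exp ((t : ℂ) • X))
    (U : LGConfig d (SO N)) (a : DEdge d) (t : ℝ) :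
    letterMat (Function.update U ε (k t * U ε)) a = (flowFactor ε X U a).eval t := by
  rcases a with ⟨e, b⟩
  by_cases h : e = ε
  · subst h
    cases b
    · rw [letterMat_update_false, ← oneParam_neg hk, soRep_oneParam_neg hX, flowFactor_eval_false]
    · rw [letterMat_update_true, hX, flowFactor_eval_true]
  · rw [letterMat_update_of_ne U _ (a := (e, b)) h, flowFactor_eval_of_ne ε X U t (a := (e, b)) h]

/-- **Insertion matrices along the flow**: `insMat (U[ε ↦ k(t)U_ε]) a = (derivFactor a)(t)`. [folklore] -/
theorem insMat_update (hk : ∀ s t, k (s + t) = k s * k t) (hX : ∀ t, soRep N (k t) = exp ((t : ℂ) • X))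
    (U : LGConfig d (SO N)) (a : DEdge d) (t : ℝ) :
    insMat ε X (Function.update U ε (k t * U ε)) a = (derivFactor ε X U a).eval t := by
  rcases a with ⟨e, b⟩
  by_cases h : e = ε
  · subst h
    cases b
    · rw [insMat_false, letterMat_update_false, ← oneParam_neg hk, soRep_oneParam_neg hX, derivFactor_eval_false,
        Matrix.mul_neg]
    · rw [insMat_true, letterMat_update_true, hX, derivFactor_eval_true, ← Matrix.mul_assoc,
        ((Commute.refl X).smul_right (t : ℂ)).exp_right.eq]
  · rw [insMat_of_ne ε X _ (a := (e, b)) h, derivFactor_eval_of_ne ε X U t (a := (e, b)) h]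

end Flow

/-! ## The first derivative: insertion sums -/

section First

variable {ε : ZdEdge d} {X : Matrix (Fin N) (Fin N) ℂ} {k : ℝ → SO N}

/-- `map` and `set` commute. [folklore] -/
theorem map_set_eq {α β : Type*} (f : α → β) : ∀ (l : List α) (n : ℕ) (a : α),
    (l.set n a).map f = (l.map f).set n (f a)
  | [], _, _ => rfl
  | _ :: _, 0, _ => rfl
  | b :: l, n + 1, a => by simp only [List.set_cons_succ, List.map_cons, map_set_eq f l n a]

/-- ★ **The derivative of `Π_k letterMat` along the flow is the insertion sum**: at `t = 0`,
`d/dt Π_k letterMat(U_t) = Σ_x Π_k (letters of l with the x-th replaced by insMat)`. [folklore] -/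
theorem hasDerivAt_prod_letterMat (hk : ∀ s t, k (s + t) = k s * k t) (hX : ∀ t, soRep N (k t) = exp ((t : ℂ) • X))
    (U : LGConfig d (SO N)) (l : Chatterjee2019LargeN.Word d) :
    HasDerivAt (fun t : ℝ => ((l.map (letterMat (Function.update U ε (k t * U ε)))).prod))
      (∑ x : Fin l.length, (((l.map (letterMat U)).set x (insMat ε X U (l.get x)))).prod) 0 := by
  have h := hasDerivAt_of_eq_prod_map_eval (l.map (flowFactor ε X U))
    (g := fun t : ℝ => ((l.map (letterMat (Function.update U ε (k t * U ε)))).prod)) (fun t => by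
      simp only [List.map_map]
      congr 1
      exact List.map_congr_left fun a _ => letterMat_update hk hX U a t)
  refine (h.congr_deriv ?_)
  have hlen : (l.map (flowFactor ε X U)).length = l.length := List.length_map _
  rw [← (finCongr hlen).sum_comp]
  refine Finset.sum_congr rfl fun x _ => ?_
  simp only [finCongr_apply, Fin.val_cast, List.map_map, List.get_eq_getElem, List.getElem_map]
  rw [flowFactor_deriv]
  congr 2
  exact List.map_congr_left fun a _ => flowFactor_eval₀ ε X U a

/-- **The derivative of the Wilson loop variable (in `ℂ`) along the flow** is the trace of the insertion sum.
[folklore] -/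
theorem hasDerivAt_wilsonLoopVar (hk : ∀ s t, k (s + t) = k s * k t) (hX : ∀ t, soRep N (k t) = exp ((t : ℂ) • X))
    (U : LGConfig d (SO N)) (l : Chatterjee2019LargeN.Word d) :
    HasDerivAt (fun t : ℝ => ((wilsonLoopVar N l (Function.update U ε (k t * U ε)) : ℝ) : ℂ))
      (∑ x : Fin l.length, ((((l.map (letterMat U)).set x (insMat ε X U (l.get x)))).prod).trace) 0 := by
  have h := hasDerivAt_trace (hasDerivAt_prod_letterMat hk hX U l (ε := ε))
  rw [Matrix.trace_sum] at h
  exact h.congr_of_eventuallyEq (Filter.Eventually.of_forall fun t => ofReal_wilsonLoopVar N l _)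

end First

/-! ## The second derivative: double insertions -/

section Second

variable {ε : ZdEdge d} {X : Matrix (Fin N) (Fin N) ℂ} {k : ℝ → SO N}

/-- The insertion product with the `x`-th letter replaced by its insertion matrix (as a function of `U`). [folklore] -/
def insProd (ε : ZdEdge d) (X : Matrix (Fin N) (Fin N) ℂ) (l : Chatterjee2019LargeN.Word d) (x : Fin l.length)
    (U : LGConfig d (SO N)) : Matrix (Fin N) (Fin N) ℂ :=
  ((l.map (letterMat U)).set x (insMat ε X U (l.get x))).prod

/-- The double-insertion product: letters `x` and `y` replaced by insertion matrices, or — on the diagonal `y = x` —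
the letter `x` by its double-insertion matrix. [folklore] -/
def ins2Prod (ε : ZdEdge d) (X : Matrix (Fin N) (Fin N) ℂ) (l : Chatterjee2019LargeN.Word d) (x y : Fin l.length)
    (U : LGConfig d (SO N)) : Matrix (Fin N) (Fin N) ℂ :=
  ((((l.map (letterMat U)).set x (insMat ε X U (l.get x))).set y
    (if y = x then ins2Mat ε X U (l.get x) else insMat ε X U (l.get y)))).prod

/-- ★ **The derivative of an insertion product along the flow is the double-insertion sum.** [folklore] -/
theorem hasDerivAt_insProd (hk : ∀ s t, k (s + t) = k s * k t) (hX : ∀ t, soRep N (k t) = exp ((t : ℂ) • X))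
    (U : LGConfig d (SO N)) (l : Chatterjee2019LargeN.Word d) (x : Fin l.length) :
    HasDerivAt (fun t : ℝ => insProd ε X l x (Function.update U ε (k t * U ε)))
      (∑ y : Fin l.length, ins2Prod ε X l x y U) 0 := by
  have h := hasDerivAt_of_eq_prod_map_eval ((l.map (flowFactor ε X U)).set x (derivFactor ε X U (l.get x)))
    (g := fun t : ℝ => insProd ε X l x (Function.update U ε (k t * U ε))) (fun t => by
      rw [insProd, map_set_eq, List.map_map, insMat_update hk hX]
      congr 2
      exact List.map_congr_left fun a _ => letterMat_update hk hX U a t)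
  refine h.congr_deriv ?_
  have hlen : ((l.map (flowFactor ε X U)).set x (derivFactor ε X U (l.get x))).length = l.length := by
    rw [List.length_set, List.length_map]
  rw [← (finCongr hlen).sum_comp]
  refine Finset.sum_congr rfl fun y _ => ?_
  have hmap : ((l.map (flowFactor ε X U)).set x (derivFactor ε X U (l.get x))).map ExpFactor.eval₀ =
      (l.map (letterMat U)).set x (insMat ε X U (l.get x)) := by
    rw [map_set_eq, List.map_map, derivFactor_eval₀]
    congr 1
    exact List.map_congr_left fun a _ => flowFactor_eval₀ ε X U a
  have hget : (((l.map (flowFactor ε X U)).set x (derivFactor ε X U (l.get x))).get y).deriv =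
      if Fin.cast hlen y = x then ins2Mat ε X U (l.get x) else insMat ε X U (l.get (Fin.cast hlen y)) := by
    simp only [List.get_eq_getElem, List.getElem_set, List.getElem_map]
    split_ifs with h1 h2 h2
    · exact derivFactor_deriv ε X U _
    · exact absurd (Fin.ext h1.symm) h2
    · exact absurd (congrArg Fin.val h2).symm h1
    · rw [flowFactor_deriv]
      rfl
  rw [hmap, ins2Prod, finCongr_apply, hget]
  rfl

/-- Its trace form. [folklore] -/
theorem hasDerivAt_trace_insProd (hk : ∀ s t, k (s + t) = k s * k t) (hX : ∀ t, soRep N (k t) = exp ((t : ℂ) • X))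
    (U : LGConfig d (SO N)) (l : Chatterjee2019LargeN.Word d) (x : Fin l.length) :
    HasDerivAt (fun t : ℝ => (insProd ε X l x (Function.update U ε (k t * U ε))).trace)
      (∑ y : Fin l.length, (ins2Prod ε X l x y U).trace) 0 := by
  have h := hasDerivAt_trace (hasDerivAt_insProd hk hX U l x (ε := ε))
  rwa [Matrix.trace_sum] at h

end Second

end SOMasterLoop

end Summit.QuantumFields.GaugeBoot
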